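import Summits.FinalStateConjecture.FinalStateConjecture.Theorems.EIHFluxBalanceInertialRecessionStubHigherOrderAnsatzField

/-!
# Route EIHFluxBalance — `InertialRecession` (E′), line `SketchCleanExcision`, skeleton r13,
# stub `stub_higherOrderSlaving` (EF): the `3`-jet of the frozen ansatz at a slice point through
# the frozen field and the lab-time variation fields

Helper file for the crux `stmt-FinalStateConjecture-17403`
(`Summit.FinalStateConjecture.FinalStateConjecture.Theses.EIHFluxBalance.InertialRecession`, E′),
registered stub `stub_higherOrderSlaving` (orders two and three of frozen-vacuum slaving).

`higherOrder_sliceModel`: at a point `x` of the slice `{x⁰ = t}` where all painted radii are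
positive, the value and the first three derivatives of the frozen ansatz
`g₀ = Φ ∘ (x⁰, id)` (`…StubHigherOrderAnsatzField`) are those of the FROZEN field `G₀ = Φ(t, ·)`
plus explicit combinations of `dx⁰` with the VARIATION fields `P_m = ∂ₛᵐΦ(t, ·)` and their
derivatives (`higherOrder_sliceJets` of `…StubHigherOrderSliceJets`, with the variations written as
iterated `s`-derivatives, `higherOrder_sliceVariation_eq_iteratedDeriv`). The variation fields are
sums over the holes of the variations of the single painted summands
(`higherOrder_iteratedDeriv_ansatzField`).

No definitions, no named facts, no `sorry`.
-/

set_option linter.dupNamespace false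
set_option maxSynthPendingDepth 6
set_option synthInstance.maxHeartbeats 200000

noncomputable section

namespace Summit.FinalStateConjecture.FinalStateConjecture.Theorems.SublinearIsFree.Slaving

open scoped Topology ContDiff BigOperators
open Filter Set Function Literature.Geometry.Lorentzian
  Summit.FinalStateConjecture.FinalStateConjecture.Theorems

set_option maxHeartbeats 3200000 in
/-- **The `3`-jet of the frozen ansatz at a slice point.** See the module docstring. [folklore] -/
theorem higherOrder_sliceModel (N : ℕ) (M a : Fin N → ℝ) (Λ : Fin N → ℝ → lorentzGroup)
    (ξ : Fin N → ℝ → E3)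
    (hΛ : ∀ i, ContDiff ℝ ∞ (fun t ↦ ((Λ i t : E4 ≃L[ℝ] E4) : E4 →L[ℝ] E4))) (hξ : ∀ i, ContDiff ℝ ∞ (ξ i))
    {t : ℝ} {x : E4} (hx0 : x 0 = t)
    (hrad : ∀ i, 0 < Kerr.radius (a i) (poincareInv (Λ i t) (E4.ofTimeSpace t (ξ i t)) x)) :
    let Φ : ℝ × E4 → E4 →L[ℝ] E4 →L[ℝ] ℝ := fun q ↦ Minkowski.bilin + ∑ i, (boostedKerrBilin (Λ i q.1)
      (E4.ofTimeSpace q.1 (ξ i q.1)) (M i) (a i) q.2 - Minkowski.bilin)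
    let g₀ : E4 → E4 →L[ℝ] E4 →L[ℝ] ℝ := fun z ↦ Minkowski.bilin + ∑ i, (boostedKerrBilin (Λ i (z 0))
      (E4.ofTimeSpace (z 0) (ξ i (z 0))) (M i) (a i) z - Minkowski.bilin)
    let G₀ : E4 → E4 →L[ℝ] E4 →L[ℝ] ℝ := fun z ↦ Φ (t, z)
    let P₁ : E4 → E4 →L[ℝ] E4 →L[ℝ] ℝ := fun z ↦ deriv (fun s ↦ Φ (s, z)) t
    let P₂ : E4 → E4 →L[ℝ] E4 →L[ℝ] ℝ := fun z ↦ iteratedDeriv 2 (fun s ↦ Φ (s, z)) t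
    let P₃ : E4 → E4 →L[ℝ] E4 →L[ℝ] ℝ := fun z ↦ iteratedDeriv 3 (fun s ↦ Φ (s, z)) t
    (IsOpen {z : E4 | ∀ i, 0 < Kerr.radius (a i) (poincareInv (Λ i t) (E4.ofTimeSpace t (ξ i t)) z)} ∧
      x ∈ {z : E4 | ∀ i, 0 < Kerr.radius (a i) (poincareInv (Λ i t) (E4.ofTimeSpace t (ξ i t)) z)} ∧
      ContDiffOn ℝ ∞ G₀ {z : E4 | ∀ i, 0 < Kerr.radius (a i) (poincareInv (Λ i t) (E4.ofTimeSpace t (ξ i t)) z)} ∧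
      ContDiffOn ℝ ∞ P₁ {z : E4 | ∀ i, 0 < Kerr.radius (a i) (poincareInv (Λ i t) (E4.ofTimeSpace t (ξ i t)) z)} ∧
      ContDiffOn ℝ ∞ P₂ {z : E4 | ∀ i, 0 < Kerr.radius (a i) (poincareInv (Λ i t) (E4.ofTimeSpace t (ξ i t)) z)} ∧
      ContDiffOn ℝ ∞ P₃ {z : E4 | ∀ i, 0 < Kerr.radius (a i) (poincareInv (Λ i t) (E4.ofTimeSpace t (ξ i t)) z)}) ∧
    g₀ x = G₀ x ∧
    (∀ v, fderiv ℝ g₀ x v = fderiv ℝ G₀ x v + (v 0) • P₁ x) ∧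
    (∀ v w, fderiv ℝ (fderiv ℝ g₀) x v w = fderiv ℝ (fderiv ℝ G₀) x v w +
      (v 0) • fderiv ℝ P₁ x w + (w 0) • fderiv ℝ P₁ x v + (v 0 * w 0) • P₂ x) ∧
    (∀ y v w, fderiv ℝ (fderiv ℝ (fderiv ℝ g₀)) x y v w = fderiv ℝ (fderiv ℝ (fderiv ℝ G₀)) x y v w +
      ((v 0) • fderiv ℝ (fderiv ℝ P₁) x y w + (w 0) • fderiv ℝ (fderiv ℝ P₁) x y v +
        (y 0) • fderiv ℝ (fderiv ℝ P₁) x v w) +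
      ((v 0 * w 0) • fderiv ℝ P₂ x y + (y 0 * w 0) • fderiv ℝ P₂ x v + (y 0 * v 0) • fderiv ℝ P₂ x w) +
      (y 0 * v 0 * w 0) • P₃ x) := by
  intro Φ g₀ G₀ P₁ P₂ P₃
  set π : E4 →L[ℝ] ℝ := (EuclideanSpace.proj (0 : Fin 4) : E4 →L[ℝ] ℝ) with hπ
  have hπa : ∀ v : E4, π v = v 0 := fun v ↦ rfl
  -- the two-variable field and its domain
  obtain ⟨hUo, hΦ⟩ := higherOrder_contDiffOn_ansatzField N M a Λ ξ hΛ hξ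
  set U : Set (ℝ × E4) := {q : ℝ × E4 | ∀ i, 0 < Kerr.radius (a i) (poincareInv (Λ i q.1)
    (E4.ofTimeSpace q.1 (ξ i q.1)) q.2)} with hU
  have hxU : ((t, x) : ℝ × E4) ∈ U := hrad
  -- the slice domain
  set Us : Set E4 := {z : E4 | ∀ i, 0 < Kerr.radius (a i) (poincareInv (Λ i t) (E4.ofTimeSpace t (ξ i t)) z)}
    with hUs
  have hι : ContDiff ℝ ∞ (fun z : E4 ↦ ((t, z) : ℝ × E4)) := contDiff_prodMk_right t
  have hUso : IsOpen Us := hUo.preimage hι.continuous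
  have hxUs : x ∈ Us := hrad
  have hmemU : ∀ z ∈ Us, ((t, z) : ℝ × E4) ∈ U := fun z hz ↦ hz
  -- the derivative fields of `Φ`
  have hΦ₁ : ContDiffOn ℝ ∞ (fderiv ℝ Φ) U := hΦ.fderiv_of_isOpen hUo (by simp)
  have hΦ₂ : ContDiffOn ℝ ∞ (fderiv ℝ (fderiv ℝ Φ)) U := hΦ₁.fderiv_of_isOpen hUo (by simp)
  have hΦ₃ : ContDiffOn ℝ ∞ (fderiv ℝ (fderiv ℝ (fderiv ℝ Φ))) U := hΦ₂.fderiv_of_isOpen hUo (by simp)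
  set e : ℝ × E4 := ((1 : ℝ), (0 : E4)) with he
  -- the variation fields agree near `x` with the partial-derivative fields
  have hP₁eq : EqOn P₁ (fun z ↦ fderiv ℝ Φ (t, z) e) Us := fun z hz ↦
    (higherOrder_sliceVariation_eq_iteratedDeriv hUo hΦ (hmemU z hz)).1
  have hP₂eq : EqOn P₂ (fun z ↦ fderiv ℝ (fderiv ℝ Φ) (t, z) e e) Us := fun z hz ↦
    (higherOrder_sliceVariation_eq_iteratedDeriv hUo hΦ (hmemU z hz)).2.1
  have hP₃eq : EqOn P₃ (fun z ↦ fderiv ℝ (fderiv ℝ (fderiv ℝ Φ)) (t, z) e e e) Us := fun z hz ↦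
    (higherOrder_sliceVariation_eq_iteratedDeriv hUo hΦ (hmemU z hz)).2.2
  -- smoothness of the slice fields
  have hG₀c : ContDiffOn ℝ ∞ G₀ Us := hΦ.comp hι.contDiffOn hmemU
  have hQ₁c : ContDiffOn ℝ ∞ (fun z ↦ fderiv ℝ Φ (t, z) e) Us := (hΦ₁.comp hι.contDiffOn hmemU).clm_apply contDiffOn_const
  have hQ₂c : ContDiffOn ℝ ∞ (fun z ↦ fderiv ℝ (fderiv ℝ Φ) (t, z) e e) Us :=
    ((hΦ₂.comp hι.contDiffOn hmemU).clm_apply contDiffOn_const).clm_apply contDiffOn_const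
  have hQ₃c : ContDiffOn ℝ ∞ (fun z ↦ fderiv ℝ (fderiv ℝ (fderiv ℝ Φ)) (t, z) e e e) Us :=
    (((hΦ₃.comp hι.contDiffOn hmemU).clm_apply contDiffOn_const).clm_apply contDiffOn_const).clm_apply
      contDiffOn_const
  have hP₁c : ContDiffOn ℝ ∞ P₁ Us := hQ₁c.congr hP₁eq
  have hP₂c : ContDiffOn ℝ ∞ P₂ Us := hQ₂c.congr hP₂eq
  have hP₃c : ContDiffOn ℝ ∞ P₃ Us := hQ₃c.congr hP₃eq
  -- derivatives of the variation fields at `x`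
  have hev₁ : P₁ =ᶠ[𝓝 x] fun z ↦ fderiv ℝ Φ (t, z) e := Filter.eventually_of_mem (hUso.mem_nhds hxUs) hP₁eq
  have hev₂ : P₂ =ᶠ[𝓝 x] fun z ↦ fderiv ℝ (fderiv ℝ Φ) (t, z) e e :=
    Filter.eventually_of_mem (hUso.mem_nhds hxUs) hP₂eq
  have hD₁ : fderiv ℝ P₁ x = fderiv ℝ (fun z ↦ fderiv ℝ Φ (t, z) e) x := hev₁.fderiv_eq
  have hD₁₁ : fderiv ℝ (fderiv ℝ P₁) x = fderiv ℝ (fderiv ℝ (fun z ↦ fderiv ℝ Φ (t, z) e)) x := by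
    have hev : fderiv ℝ P₁ =ᶠ[𝓝 x] fderiv ℝ (fun z ↦ fderiv ℝ Φ (t, z) e) := hev₁.fderiv
    exact hev.fderiv_eq
  have hD₂ : fderiv ℝ P₂ x = fderiv ℝ (fun z ↦ fderiv ℝ (fderiv ℝ Φ) (t, z) e e) x := hev₂.fderiv_eq
  -- the slice jets
  have hgraph : g₀ = fun z : E4 ↦ Φ (π z, z) := rfl
  obtain ⟨j0, j1, j2, j3⟩ := higherOrder_sliceJets hUo hΦ π hxU (by rw [hπa, hx0])
  refine ⟨⟨hUso, hxUs, hG₀c, hP₁c, hP₂c, hP₃c⟩, ?_, fun v ↦ ?_, fun v w ↦ ?_, fun y v w ↦ ?_⟩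
  · rw [hgraph]; exact j0
  · rw [hgraph, j1 v, hπa, hP₁eq hxUs]
  · rw [hgraph, j2 v w, hπa, hπa, hD₁, hP₂eq hxUs]
  · rw [hgraph, j3 y v w, hπa, hπa, hπa, hD₁₁, hD₂, hP₃eq hxUs]

/-- **Registered one-line carrier form** (`higherOrder_sliceModel_EF`): the first-jet part of
`higherOrder_sliceModel`. [folklore] -/
theorem higherOrder_sliceModel_EF : open Literature.Geometry.Lorentzian in ∀ (N : ℕ) (M a : Fin N → ℝ) (Λ : Fin N → ℝ → lorentzGroup) (ξ : Fin N → ℝ → E3), (∀ i, ContDiff ℝ ((⊤ : ℕ∞) : WithTop ℕ∞) (fun t ↦ ((Λ i t : E4 ≃L[ℝ] E4) : E4 →L[ℝ] E4))) → (∀ i, ContDiff ℝ ((⊤ : ℕ∞) : WithTop ℕ∞) (ξ i)) → ∀ {t : ℝ} {x : E4}, x 0 = t → (∀ i, 0 < Kerr.radius (a i) (poincareInv (Λ i t) (E4.ofTimeSpace t (ξ i t)) x)) → ∀ v : E4, fderiv ℝ (fun z : E4 ↦ Minkowski.bilin + ∑ i, (boostedKerrBilin (Λ i (z 0)) (E4.ofTimeSpace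 (z 0) (ξ i (z 0))) (M i) (a i) z - Minkowski.bilin)) x v = fderiv ℝ (fun z : E4 ↦ (fun q : ℝ × E4 ↦ Minkowski.bilin + ∑ i, (boostedKerrBilin (Λ i q.1) (E4.ofTimeSpace q.1 (ξ i q.1)) (M i) (a i) q.2 - Minkowski.bilin)) (t, z)) x v + (v 0) • deriv (fun s ↦ (fun q : ℝ × E4 ↦ Minkowski.bilin + ∑ i, (boostedKerrBilin (Λ i q.1) (E4.ofTimeSpace q.1 (ξ i q.1)) (M i) (a i) q.2 - Minkowski.bilin)) (s, x)) t :=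
  fun N M a Λ ξ hΛ hξ _ _ hx0 hrad v ↦ (higherOrder_sliceModel N M a Λ ξ hΛ hξ hx0 hrad).2.2.1 v

end Summit.FinalStateConjecture.FinalStateConjecture.Theorems.SublinearIsFree.Slaving

end
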